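import Mathlib
import HarnessLib
import Summits.ValiantsHypothesis.ValiantsHypothesis.Theorems.LacunarySymmetroidMatrixDescartesProductPlusOneOneRiserCalculus
import Summits.ValiantsHypothesis.ValiantsHypothesis.Theorems.LacunarySymmetroidMatrixDescartesProductPlusOneOneRiserGeneralPull

/-!
# LINE (A) `product_plus_one` — one-riser interaction lemma: the LOGISTIC step (at most two crossings `Λ = (q−p)·w`)

Crux item stmt-ValiantsHypothesis-18050, LINE (A) floor structure (memo `pub/val-lit/lmr/NOTE-p7g15-18050-LINEA-incoherent-cell.md` §11, step (4)).
After a-separation (✓ `…OneRiserGeneralPull`) the one-riser count against ANY pull `Pl` is the statement «the discriminant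
`D = Λ − (q−p)·w` has at most two zeros», where `Λ(y) = Pl + y Pl′/Pl − p` is the cloud's iterated logarithmic derivative and
`w = q c y^q/(p b y^p + q c y^q)` is the riser's logistic weight, `w/(1−w) = κ·y^{q−p}`, `κ = qc/(pb)`.  Because `w/(1−w)` is a pure power,
`D = 0 ⟺ J(y) := log Λ − log(q−p−Λ) − (q−p) log y = log κ`, and `y·J′ = (q−p)·(Z − (q−p))/(q−p−Λ)` with `Z := Λ + yΛ′/Λ`:

* ★ `logistic_crossings_le_two` — if `Λ > 0` is monotone and `Z = Λ + yΛ′/Λ` STRICTLY increasing on `[lo, hi] ⊂ (0, ∞)`, then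
  `Λ(y) = n·κ yⁿ/(1 + κ yⁿ)` (`n ≥ 1`, `κ > 0`) has no three solutions `y₁ < y₂ < y₃` in `[lo, hi]` (Rolle on `J` via ✓ `eq_at_most_twice_of_deriv_factor`);
* ★★ `oneRiser_no_four_zeros_of_strictMonoZ` — composed with ✓ `oneRiser_no_four_zeros_of_pull`: a switched two-letter riser against ANY positive pull
  whose `Λ` is monotone and whose `Z` is strictly increasing on the interval has at most THREE zeros of the total Euler ratio there.

For a cloud of unswitched incoherent rows (`F_i = a_i − Σ_l b_{il} y^{e_l}`, `b_{il} ≥ 0`, `e_l ≥ 1`) the hypotheses hold because `V = ∏ F_i^{−m_i}` is a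
non-negative power series, `Λ = y V″/V′`, `Z = 1 + y V‴/V″` (memo §11 (1)–(2), paper); in kernel so far for binomial clouds (✓ `…OneRiserSeparation`).
Honest framing: a real-variable lemma + a composition; NOT `OneChangeFloorK3` / `stub_classRowK3` / `stub_polyLaw` / `MatrixDescartes` / B;
`VP ≠ VNP` NOT proved.  No definitions, no named facts; Mathlib only.
-/

set_option linter.dupNamespace false

namespace Summit.ValiantsHypothesis.ValiantsHypothesis.Theorems.LacunarySymmetroidMatrixDescartes

namespace ProductPlusOne

/-- ★ **At most two logistic crossings.**  `Λ > 0` monotone on `[lo, hi] ⊂ (0,∞)` with derivative `Λ′` and `Z = Λ + yΛ′/Λ` strictly increasing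
there; `n ≥ 1`, `κ > 0`.  Then `Λ(y) = n·κyⁿ/(1 + κyⁿ)` fails at one of any three points `y₁ < y₂ < y₃` of the interval. [this file's theorem] -/
theorem logistic_crossings_le_two (n : ℕ) (hn : 1 ≤ n) {κ : ℝ} (hκ : 0 < κ) (Λ Λ' : ℝ → ℝ) {lo hi : ℝ} (hlo : 0 < lo)
    (hder : ∀ y ∈ Set.Icc lo hi, HasDerivAt Λ (Λ' y) y) (hpos : ∀ y ∈ Set.Icc lo hi, 0 < Λ y)
    (hmono : MonotoneOn Λ (Set.Icc lo hi)) (hZ : StrictMonoOn (fun y => Λ y + y * Λ' y / Λ y) (Set.Icc lo hi))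
    {y₁ y₂ y₃ : ℝ} (h1 : lo ≤ y₁) (h12 : y₁ < y₂) (h23 : y₂ < y₃) (h3 : y₃ ≤ hi)
    (e1 : Λ y₁ = n * (κ * y₁ ^ n / (1 + κ * y₁ ^ n))) (e2 : Λ y₂ = n * (κ * y₂ ^ n / (1 + κ * y₂ ^ n)))
    (e3 : Λ y₃ = n * (κ * y₃ ^ n / (1 + κ * y₃ ^ n))) : False := by
  have hnR : (0 : ℝ) < n := by exact_mod_cast hn
  -- on `[y₁, y₃]`: `0 < Λ < n`
  have hI : ∀ y ∈ Set.Icc y₁ y₃, y ∈ Set.Icc lo hi := fun y hy => ⟨h1.trans hy.1, hy.2.trans h3⟩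
  have hy3 : y₃ ∈ Set.Icc lo hi := ⟨by linarith, h3⟩
  have hΛ3 : Λ y₃ < n := by
    rw [e3]
    have hy3pos : 0 < y₃ := by linarith
    have hp : 0 < κ * y₃ ^ n := by positivity
    have : κ * y₃ ^ n / (1 + κ * y₃ ^ n) < 1 := by rw [div_lt_one (by linarith)]; linarith
    nlinarith
  have hlt : ∀ y ∈ Set.Icc y₁ y₃, Λ y < n := fun y hy =>
    (hmono (hI y hy) hy3 hy.2).trans_lt hΛ3
  -- `J = log Λ − log (n − Λ) − n log y` and its derivative `g·(Z − n)`
  set J : ℝ → ℝ := fun y => Real.log (Λ y) - Real.log ((n : ℝ) - Λ y) - n * Real.log y with hJ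
  set g : ℝ → ℝ := fun y => (n : ℝ) / (y * ((n : ℝ) - Λ y)) with hg
  set Dz : ℝ → ℝ := fun y => Λ y + y * Λ' y / Λ y - n with hDz
  have hderJ : ∀ y ∈ Set.Icc y₁ y₃, ∃ f' : ℝ, HasDerivAt J f' y ∧ f' = g y * Dz y := by
    intro y hy
    have hy0 : 0 < y := hlo.trans_le (hI y hy).1
    have hΛ := hpos y (hI y hy)
    have hnΛ : 0 < (n : ℝ) - Λ y := by linarith [hlt y hy]
    have hd := hder y (hI y hy)
    have hA : HasDerivAt (fun t => Real.log (Λ t)) (Λ' y / Λ y) y := hd.log hΛ.ne'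
    have hB : HasDerivAt (fun t => Real.log ((n : ℝ) - Λ t)) ((0 - Λ' y) / ((n : ℝ) - Λ y)) y :=
      ((hasDerivAt_const y (n : ℝ)).sub hd).log hnΛ.ne'
    have hC : HasDerivAt (fun t => (n : ℝ) * Real.log t) ((n : ℝ) * (1 / y)) y :=
      (Real.hasDerivAt_log hy0.ne').const_mul (n : ℝ) |>.congr_deriv (by ring)
    refine ⟨_, (hA.sub hB).sub hC, ?_⟩
    simp only [hg, hDz]
    field_simp
    ring
  have hgpos : ∀ y ∈ Set.Icc y₁ y₃, 0 < g y := by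
    intro y hy
    have hy0 : 0 < y := hlo.trans_le (hI y hy).1
    have hnΛ : 0 < (n : ℝ) - Λ y := by linarith [hlt y hy]
    simp only [hg]; positivity
  have hDmono : StrictMonoOn Dz (Set.Icc y₁ y₃) := by
    intro x hx y hy hxy
    have := hZ (hI x hx) (hI y hy) hxy
    simp only [hDz]; linarith
  -- `J(y_i) = log κ`
  have hJval : ∀ y ∈ Set.Icc y₁ y₃, Λ y = n * (κ * y ^ n / (1 + κ * y ^ n)) → J y = Real.log κ := by
    intro y hy e
    have hy0 : 0 < y := hlo.trans_le (hI y hy).1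
    have hp : 0 < κ * y ^ n := by positivity
    have hΛ : Λ y = n * κ * y ^ n / (1 + κ * y ^ n) := by rw [e]; ring
    have hnΛ : (n : ℝ) - Λ y = n / (1 + κ * y ^ n) := by rw [hΛ]; field_simp; ring
    simp only [hJ]
    rw [hnΛ, hΛ, Real.log_div (by positivity) (by positivity), Real.log_div (by positivity) (by positivity),
      Real.log_mul (by positivity) (by positivity), Real.log_mul (by positivity) (by positivity), Real.log_pow]
    ring
  have eJ1 := hJval y₁ ⟨le_rfl, by linarith⟩ e1
  have eJ2 := hJval y₂ ⟨h12.le, h23.le⟩ e2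
  have eJ3 := hJval y₃ ⟨by linarith, le_rfl⟩ e3
  exact eq_at_most_twice_of_deriv_factor hderJ hgpos hDmono le_rfl h12 h23 le_rfl (eJ1.trans eJ2.symm) (eJ2.trans eJ3.symm)

/-- ★★ **ONE RISER AGAINST ANY PULL WITH MONOTONE `Λ` AND STRICTLY INCREASING `Z` ⇒ AT MOST THREE ZEROS.**  Riser `a − b x^p − c x^q`
(`p = e₁+1`, `q = e₁+e₂+2`, `b, c > 0`, `a` free) switched on `[x₁, x₄] ⊂ (0, ∞)`; pull `Pl > 0` with derivative `Pl′`; `Λ(y) := Pl + yPl′/Pl − p`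
positive and monotone with derivative `Λ′`, and `Z = Λ + yΛ′/Λ` strictly increasing on the interval.  Then the total Euler ratio
`(p b x^p + q c x^q)/(b x^p + c x^q − a) − Pl` does not vanish at four points `x₁ < x₂ < x₃ < x₄`. [this file's theorem] -/
theorem oneRiser_no_four_zeros_of_strictMonoZ (e₁ e₂ : ℕ) {a b c : ℝ} (hb : 0 < b) (hc : 0 < c) (Pl Pl' Λ' : ℝ → ℝ)
    {x₁ x₂ x₃ x₄ : ℝ} (h0 : 0 < x₁) (h12 : x₁ < x₂) (h23 : x₂ < x₃) (h34 : x₃ < x₄)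
    (hsw : ∀ x ∈ Set.Icc x₁ x₄, a < b * x ^ (e₁ + 1) + c * x ^ (e₁ + e₂ + 2))
    (hPlpos : ∀ x ∈ Set.Icc x₁ x₄, 0 < Pl x) (hPlder : ∀ x ∈ Set.Icc x₁ x₄, HasDerivAt Pl (Pl' x) x)
    (hΛpos : ∀ x ∈ Set.Icc x₁ x₄, 0 < Pl x + x * Pl' x / Pl x - ((e₁ : ℝ) + 1))
    (hΛder : ∀ x ∈ Set.Icc x₁ x₄, HasDerivAt (fun y => Pl y + y * Pl' y / Pl y - ((e₁ : ℝ) + 1)) (Λ' x) x)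
    (hΛmono : MonotoneOn (fun y => Pl y + y * Pl' y / Pl y - ((e₁ : ℝ) + 1)) (Set.Icc x₁ x₄))
    (hZ : StrictMonoOn (fun y => (Pl y + y * Pl' y / Pl y - ((e₁ : ℝ) + 1))
        + y * Λ' y / (Pl y + y * Pl' y / Pl y - ((e₁ : ℝ) + 1))) (Set.Icc x₁ x₄))
    (hzero : ∀ x ∈ ({x₁, x₂, x₃, x₄} : Set ℝ),
      (((e₁ : ℝ) + 1) * b * x ^ (e₁ + 1) + ((e₁ : ℝ) + e₂ + 2) * c * x ^ (e₁ + e₂ + 2))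
          / (b * x ^ (e₁ + 1) + c * x ^ (e₁ + e₂ + 2) - a) - Pl x = 0) : False := by
  refine oneRiser_no_four_zeros_of_pull e₁ e₂ hb hc Pl Pl' h0 h12 h23 h34 hsw hPlpos hPlder ?_ hzero
  intro y₁ y₂ y₃ hy1 hy12 hy23 hy3 d1 d2 d3
  set κ : ℝ := ((e₁ : ℝ) + e₂ + 2) * c / (((e₁ : ℝ) + 1) * b) with hκ
  have hκ0 : 0 < κ := by rw [hκ]; positivity
  -- rewrite `D(y) = 0` as `Λ(y) = (e₂+1)·κ y^{e₂+1}/(1 + κ y^{e₂+1})`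
  have conv : ∀ y, x₁ < y →
      Pl y + y * Pl' y / Pl y - ((e₁ : ℝ) + 1) - ((e₂ : ℝ) + 1) * ((((e₁ : ℝ) + e₂ + 2) * c * y ^ (e₁ + e₂ + 2))
          / (((e₁ : ℝ) + 1) * b * y ^ (e₁ + 1) + ((e₁ : ℝ) + e₂ + 2) * c * y ^ (e₁ + e₂ + 2))) = 0 →
      Pl y + y * Pl' y / Pl y - ((e₁ : ℝ) + 1) = ((e₂ + 1 : ℕ) : ℝ) * (κ * y ^ (e₂ + 1) / (1 + κ * y ^ (e₂ + 1))) := by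
    intro y hy hd
    have hy0 : 0 < y := h0.trans hy
    have hw : (((e₁ : ℝ) + e₂ + 2) * c * y ^ (e₁ + e₂ + 2))
          / (((e₁ : ℝ) + 1) * b * y ^ (e₁ + 1) + ((e₁ : ℝ) + e₂ + 2) * c * y ^ (e₁ + e₂ + 2))
        = κ * y ^ (e₂ + 1) / (1 + κ * y ^ (e₂ + 1)) := by
      have hy1 : 0 < y ^ (e₁ + 1) := pow_pos hy0 _
      have hsplit : y ^ (e₁ + e₂ + 2) = y ^ (e₁ + 1) * y ^ (e₂ + 1) := by rw [← pow_add]; ring_nf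
      rw [hsplit, hκ, div_eq_div_iff (by positivity) (by positivity)]
      field_simp
    rw [hw] at hd
    push_cast
    linarith
  exact logistic_crossings_le_two (e₂ + 1) (by omega) hκ0
    (fun y => Pl y + y * Pl' y / Pl y - ((e₁ : ℝ) + 1)) Λ' h0 hΛder hΛpos hΛmono hZ
    hy1.le hy12 hy23 hy3.le (conv y₁ hy1 d1) (conv y₂ (hy1.trans hy12) d2) (conv y₃ ((hy1.trans hy12).trans hy23) d3)

end ProductPlusOne

end Summit.ValiantsHypothesis.ValiantsHypothesis.Theorems.LacunarySymmetroidMatrixDescartes
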